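import Mathlib.NumberTheory.NumberField.CanonicalEmbedding.Basic
import Mathlib.NumberTheory.NumberField.AdeleRing
import Mathlib.NumberTheory.NumberField.InfiniteAdeleRing
import Mathlib.Algebra.BigOperators.Finprod
import Literature.NumberTheory.Automorphic.RealMatrixGroups
import Literature.NumberTheory.Automorphic.AutomorphicForms
import Literature.NumberTheory.Automorphic.GLnAdelicStructure
import Literature.NumberTheory.Automorphic.AdelicGroupData
import HarnessLib

-- provenance: harness21/H21/H21/Prelude/AutomorphicL/AdelicGLnGlue.lean @ 3ac2cd8 (interim HEAD d8f2665); M5 mechanical rewrite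
/-!
# Adelic glue for `GL_n` over a number field and the automorphy datum `AutomorphyDatum.gl`

Trunk: AutomorphicL (prelude, item I13 `AdelicGLnGlue`; notions `automorphic_form`, `adele_ring`;
reviews 9, 12). H21 dependencies: `RealMatrixGroups` (I8), `AutomorphicForms` (I12),
G19 `GLnAdelicStructure`, G19 `AdelicGroupData`.

Let `K` be a number field, `𝔸_K = K_∞ × 𝔸_K^∞` its adele ring (`NumberField.AdeleRing (𝓞 K) K`,
`K_∞ = InfiniteAdeleRing K`, `𝔸_K^∞ = FiniteAdeleRing (𝓞 K) K`) and
`K_∞ ≅ ℝ^{r₁} × ℂ^{r₂} = mixedSpace K` (Mathlib `InfiniteAdeleRing.ringEquiv_mixedSpace`). This file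
glues the accepted axiomatic datum `AdelicGroupData.gl n K` (`Adelic = GL_n(𝔸_K)`) to the
archimedean theory of linear real groups (`RealMatrixGroup`) and produces the honest automorphy
datum `AutomorphyDatum.gl n K` of Borel–Jacquet §4.1 for `G = GL_n`:

* `archGroupGL n K = GL_n(K_∞)` as the full linear real group `RealMatrixGroup.gl` over the real
  Banach `*`-algebra `mixedSpace K`, and `Kinf n K = K_∞ = GL_n(K_∞) ∩ U(n, mixedSpace K)`
  (`= ∏_{w real} O(n) × ∏_{w complex} U(n)`, `maximalCompact_archGroupGL_eq`, proved; compact,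
  `isCompact_Kinf`);
* `GLn.infiniteEquivMixed : GL_n(InfiniteAdeleRing K) ≃* GL_n(mixedSpace K)`,
  `GLn.toMixed : GL_n(𝔸_K) →* GL_n(mixedSpace K)` (archimedean component; G19's `GLn.fstHom`
  followed by `infiniteEquivMixed` — G19's `GLn.fstHom`/`GLn.sndHom`/`GLn.ofFinite` are the
  projections and the finite inclusion and are **not** redefined, review 9),
  `GLn.ofInfinite : GL_n(mixedSpace K) →* GL_n(𝔸_K)`, `g ↦ (g, 1)` (via G19's `oneAddHom` trick,
  exactly like `GLn.ofFinite`), with `GLn.toMixed_ofInfinite`, `GLn.sndHom_ofInfinite`,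
  `GLn.commute_ofInfinite_ofFinite`, `GLn.continuous_ofInfinite` (all proved; the continuity of
  `(ringEquiv_mixedSpace K).symm`, absent from Mathlib, is `continuous_ringEquiv_mixedSpace_symm`);
* the adelic height `adelicHeightGL n K g = H_∞(g) · ∏ᶠ_v H_v(g)` with
  `H_v(g) = max_{i,j} (|g_{ij}|_v ⊔ |(g⁻¹)_{ij}|_v)` (Borel–Jacquet §1.2, Moeglin–Waldspurger I.2.2)
  — pure data; its properties `GLn.mulSupport_localHeight_finite`, `adelicHeightGL_pos`,
  `adelicHeightGL_mul_le` are named facts (review 12: no height axiom in the datum);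
* the levels `finiteLevelsGL n K` = images under `GLn.ofFinite` of compact open subgroups of
  `GL_n(𝔸_K^∞)`, non-empty by G19's `glFiniteIntegralLevel` (`glIntegralLevel_mem_finiteLevelsGL`,
  proved from `hcpt`), and `principalCongruenceLevel_mem_finiteLevelsGL` (named fact);
* `AutomorphyDatum.gl n K hcpt : AutomorphyDatum (AdelicGroupData.gl n K) (mixedSpace K) (Fin n)`
  with every field real and short (`hcpt : isCompact_glFiniteIntegralLevel n K`, see the downstream
  note).

## Design notes

* (H1) `attribute [local instance 100] LieRing.ofAssociativeRing`; (H5) `open scoped Classical`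
  (the place subtypes `{w // IsReal w}`, `{w // IsComplex w}` are `Fintype` classically); (H3) no
  normed *matrix* instance is used: heights are built from norms of *entries* in the normed rings
  `mixedSpace K` (sup norm on `ℝ^{r₁} × ℂ^{r₂}`) and `K_v` (Mathlib
  `instNormedFieldValuedAdicCompletion`, `‖x‖ = q_v^{-ord_v x}`).
* Local heights are `ℝ≥0`-valued `Finset.sup` over `Fin n × Fin n` (so no `Finset.sup'`
  non-emptiness obligation); for `n = 0` every local height, hence `adelicHeightGL 0 K`, is the
  junk value `0`, and `adelicHeightGL_pos` assumes `[NeZero n]`. The archimedean factor uses the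
  sup norm of `mixedSpace K`, i.e. `max_w` instead of Borel–Jacquet's `∏_w` over archimedean
  places; the two heights define the same moderate-growth condition (`HasModerateGrowth` uses
  `1 ⊔ height` and arbitrary exponents).
* `isCompact_Kinf` is *derived* from `RealMatrixGroup.isCompact_maximalCompact` and the (proved)
  lemma `isStarFormallyReal_mixedSpace` asked for by review 11 of I8. The named facts (unproved
  here) are `isCompact_Kinf`, `GLn.mulSupport_localHeight_finite`, `adelicHeightGL_pos`,
  `adelicHeightGL_mul_le` (Borel–Jacquet §1.2) and `principalCongruenceLevel_mem_finiteLevelsGL`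
  (Godement–Jacquet §10); `GLn.mulSupport_localHeight_finite` and `adelicHeightGL_pos` carry
  `[NeZero n]` because of the `n = 0` junk value.
* `GLn.localHeight` is written with `GeneralLinearGroup.map (adeleEval K v) g`, which is
  `(AdelicGroupData.gl n K).toLocal v g` definitionally (`AdelicGroupData.gl_toLocal`), so that the
  coercion to matrices over `K_v` elaborates without unfolding the structure projection.

## Downstream note (M5 migration)

`AutomorphyDatum.gl n K hcpt` now takes the named fact
`hcpt : isCompact_glFiniteIntegralLevel n K` (`GLnAdelicStructure`) as an explicit parameter (it
supplies non-emptiness of the admissible levels via `finiteLevelsGL_nonempty`). This term appears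
INSIDE TYPES in some 40 declarations of the importers
`Literature.NumberTheory.Automorphic.AutomorphicRepsGL` (`AutomorphicRepData (AutomorphyDatum.gl n K)`,
`IsAutomorphicForm`, `cuspFormsGL`), `LangAutomorphicForms`, `ReciprocityGLn` and `Sweep2` (the
`lang`-family target statements), whose migrate items are blocked/open on this file: after this
lands they must thread `hcpt` as an explicit parameter (do **not** universally quantify it inside
statements). The whole cascade disappears if `isCompact_glFiniteIntegralLevel` is discharged
(`GL_n(𝒪̂_K)` is a closed subset of matrices over the compact `∏_v 𝒪_v`) — a discharge item is
worth opening before the importers are rewritten around the parameter.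

## Mathlib

Used (verified by grep): `NumberField.mixedEmbedding.mixedSpace` with its `NormedCommRing`,
`NormedAlgebra ℝ/ℚ`, `CompleteSpace`, `StarRing`, `StarModule ℝ`, `ContinuousStar` instances
(products of pi types), `InfiniteAdeleRing.ringEquiv_mixedSpace(_apply)`,
`InfinitePlace.Completion.isometryEquivRealOfIsReal/isometryEquivComplexOfIsComplex`,
`RingEquiv.mapMatrix`, `Units.mapEquiv`, `Units.continuous_map`, `Continuous.matrix_map`,
`Matrix.GeneralLinearGroup.map/ext/ext_iff`, `NonUnitalRingHom.prod`, `finprod`,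
`Subgroup.map_le_range`. Mathlib has no continuity statement for `ringEquiv_mixedSpace`, no
`GL_n(K_∞) ↪ GL_n(𝔸_K)`, no adelic height and no automorphy data (all checked by grep).

## References

* A. Borel, H. Jacquet, *Automorphic forms and automorphic representations*, Proc. Sympos. Pure
  Math. 33 (Corvallis 1979), part 1, §1.2, §4.1–4.2.
* C. Moeglin, J.-L. Waldspurger, *Spectral decomposition and Eisenstein series* (1995), I.2.2.
* R. Godement, H. Jacquet, *Zeta functions of simple algebras*, LNM 260 (1972), §10.
* A. W. Knapp, *Lie Groups Beyond an Introduction* (2002), I.§1, I.§17.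
* J. W. S. Cassels, A. Fröhlich (eds.), *Algebraic Number Theory* (1967), Ch. II §14.
-/

-- Mathlib idiom (Mathlib/Algebra/Lie/OfAssociative.lean); needed to mention Lie subalgebras of matrix algebras
attribute [local instance 100] LieRing.ofAssociativeRing

open scoped MatrixGroups Matrix ContDiff Classical NNReal
open NumberField NumberField.mixedEmbedding IsDedekindDomain

noncomputable section

namespace Literature.NumberTheory.Automorphic

variable (n : ℕ) (K : Type) [Field K] [NumberField K]

/-! ## The archimedean group `GL_n(K_∞)` and `K_∞` -/

section Arch

/-- The archimedean group `G_∞ = GL_n(K ⊗_ℚ ℝ) = GL_n(ℝ)^{r₁} × GL_n(ℂ)^{r₂}` of `GL_n` over the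
number field `K`, as the full linear real group `GL (Fin n) (mixedSpace K)` over the real Banach
`*`-algebra `mixedSpace K = ℝ^{r₁} × ℂ^{r₂}` (Lie algebra: all of `M_n(mixedSpace K)`).
Borel–Jacquet 1979, §1.1 and §4.1; Knapp, I.§1. [cite: BorelJacquet1979, §1.1 and §4.1] -/
def archGroupGL : RealMatrixGroup (mixedSpace K) (Fin n) :=
  RealMatrixGroup.gl _ _

/-- The carrier of `archGroupGL n K` is all of `GL_n(K_∞)`. Borel–Jacquet 1979, §4.1. [cite: BorelJacquet1979, §4.1] -/
@[simp]
theorem archGroupGL_carrier : (archGroupGL n K).carrier = ⊤ := rfl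

/-- The Lie algebra of `archGroupGL n K` is all of `M_n(K_∞)`. Borel–Jacquet 1979, §4.1. [cite: BorelJacquet1979, §4.1] -/
@[simp]
theorem archGroupGL_lie : (archGroupGL n K).lie = ⊤ := rfl

/-- The maximal compact subgroup
`K_∞ = GL_n(K_∞) ∩ U(n, K_∞) = ∏_{w real} O(n) × ∏_{w complex} U(n)` of `GL_n(K_∞)`. Borel–Jacquet 1979, §1.1 and §4.1; Knapp, I.§1. [cite: BorelJacquet1979, §1.1 and §4.1] -/
def Kinf : Subgroup (GL (Fin n) (mixedSpace K)) := (archGroupGL n K).maximalCompact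

/-- `K_∞` is the unitary subgroup `U(n, mixedSpace K)` of `GL_n(mixedSpace K)`
(`RealMatrixGroup.maximalCompact_gl`). Knapp, I.§1. [folklore] -/
theorem Kinf_eq_unitarySubgroupGL : Kinf n K = unitarySubgroupGL (mixedSpace K) (Fin n) :=
  RealMatrixGroup.maximalCompact_gl

/-- `mixedSpace K = ℝ^{r₁} × ℂ^{r₂}` (with complex conjugation on the `ℂ`-factors) is
star-formally real: `∑ᵢ star xᵢ * xᵢ = 0` forces all `xᵢ = 0` (componentwise this is
`∑ xᵢ² = 0` in `ℝ` and `∑ |zᵢ|² = 0` in `ℂ`). This is the hypothesis of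
`RealMatrixGroup.isCompact_maximalCompact` (review 11 of I8). Knapp, I.§1. [folklore] -/
theorem isStarFormallyReal_mixedSpace : IsStarFormallyReal (mixedSpace K) := by
  intro m x hx i
  refine Prod.ext (funext fun w => ?_) (funext fun w => ?_)
  · have h := congrFun (congrArg Prod.fst hx) w
    simp only [Prod.fst_sum, Finset.sum_apply, Prod.fst_mul, Pi.mul_apply, Prod.fst_star,
      star_trivial, Prod.fst_zero, Pi.zero_apply] at h
    exact mul_self_eq_zero.mp ((Finset.sum_eq_zero_iff_of_nonneg fun j _ =>
      mul_self_nonneg ((x j).1 w)).mp h i (Finset.mem_univ i))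
  · have h := congrFun (congrArg Prod.snd hx) w
    simp only [Prod.snd_sum, Finset.sum_apply, Prod.snd_mul, Pi.mul_apply, Prod.snd_star,
      Pi.star_apply, Complex.star_def, Complex.conj_mul', Prod.snd_zero, Pi.zero_apply] at h
    have h' : ∑ j, ‖(x j).2 w‖ ^ 2 = 0 := by exact_mod_cast h
    exact norm_eq_zero.mp (pow_eq_zero_iff two_ne_zero |>.mp
      ((Finset.sum_eq_zero_iff_of_nonneg fun j _ => sq_nonneg ‖(x j).2 w‖).mp h' i
        (Finset.mem_univ i)))

/-- `K_∞ = ∏ O(n) × ∏ U(n)` is compact (Borel–Jacquet 1979, §1.1; Knapp, I.§1: compactness of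
`O(n)` and `U(n)`), derived from `RealMatrixGroup.isCompact_maximalCompact`. [cite: BorelJacquet1979, §1.1] -/
def isCompact_Kinf : Prop :=
  IsCompact (Kinf n K : Set (GL (Fin n) (mixedSpace K)))

/- interim proof relied on results that are now named facts (D-0014); demoted to a fact by the M5 import, proof preserved:
:=
  (archGroupGL n K).isCompact_maximalCompact (isStarFormallyReal_mixedSpace K)
-/

/-- Evaluation of `mixedSpace K = ℝ^{r₁} × ℂ^{r₂}` at a real place `w`, a ring homomorphism to `ℝ`
(`Pi.evalRingHom` after `RingHom.fst`). Borel–Jacquet 1979, §1.1 (`G_∞ = ∏_w G_w`). [cite: BorelJacquet1979, §1.1 ( G_∞ = ∏_w G_w] -/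
def mixedSpaceEvalReal (w : {w : InfinitePlace K // w.IsReal}) : mixedSpace K →+* ℝ :=
  (Pi.evalRingHom _ w).comp (RingHom.fst _ _)

/-- Evaluation of `mixedSpace K = ℝ^{r₁} × ℂ^{r₂}` at a complex place `w`, a ring homomorphism to
`ℂ` (`Pi.evalRingHom` after `RingHom.snd`). Borel–Jacquet 1979, §1.1. [cite: BorelJacquet1979, §1.1] -/
def mixedSpaceEvalComplex (w : {w : InfinitePlace K // w.IsComplex}) : mixedSpace K →+* ℂ :=
  (Pi.evalRingHom _ w).comp (RingHom.snd _ _)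

omit [NumberField K] in
/-- `mixedSpaceEvalReal K w x = x.1 w` (definitional). [folklore] -/
@[simp]
theorem mixedSpaceEvalReal_apply (w : {w : InfinitePlace K // w.IsReal}) (x : mixedSpace K) :
    mixedSpaceEvalReal K w x = x.1 w := rfl

omit [NumberField K] in
/-- `mixedSpaceEvalComplex K w x = x.2 w` (definitional). [folklore] -/
@[simp]
theorem mixedSpaceEvalComplex_apply (w : {w : InfinitePlace K // w.IsComplex})
    (x : mixedSpace K) : mixedSpaceEvalComplex K w x = x.2 w := rfl

omit [NumberField K] in
/-- Two matrices over `mixedSpace K = ℝ^{r₁} × ℂ^{r₂}` agree iff they agree after evaluation at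
every real and every complex place. Borel–Jacquet 1979, §1.1 (`G_∞ = ∏_w G_w`). [cite: BorelJacquet1979, §1.1 ( G_∞ = ∏_w G_w] -/
theorem mixedSpace_matrix_ext {A B : Matrix (Fin n) (Fin n) (mixedSpace K)}
    (h₁ : ∀ w, A.map (mixedSpaceEvalReal K w) = B.map (mixedSpaceEvalReal K w))
    (h₂ : ∀ w, A.map (mixedSpaceEvalComplex K w) = B.map (mixedSpaceEvalComplex K w)) :
    A = B :=
  Matrix.ext fun i j => Prod.ext (funext fun w => congrFun (congrFun (h₁ w) i) j)
    (funext fun w => congrFun (congrFun (h₂ w) i) j)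

/-- **`K_∞ = ∏_{w real} O(n) × ∏_{w complex} U(n)`**: an element of `GL_n(K_∞)` lies in `K_∞` iff
its component at every real place lies in `O(n) = U(n, ℝ)` and its component at every complex
place lies in `U(n) = U(n, ℂ)` (`unitarySubgroupGL`, pulled back along the place evaluations;
proved: `star` on `M_n(mixedSpace K)` is computed place by place).
Borel–Jacquet 1979, §1.1; Knapp, I.§1 and I.§17. [cite: BorelJacquet1979, §1.1] -/
theorem maximalCompact_archGroupGL_eq :
    (archGroupGL n K).maximalCompact =
      (⨅ w : {w : InfinitePlace K // w.IsReal}, (unitarySubgroupGL ℝ (Fin n)).comap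
          (Matrix.GeneralLinearGroup.map (mixedSpaceEvalReal K w))) ⊓
        ⨅ w : {w : InfinitePlace K // w.IsComplex}, (unitarySubgroupGL ℂ (Fin n)).comap
          (Matrix.GeneralLinearGroup.map (mixedSpaceEvalComplex K w)) := by
  ext g
  simp only [RealMatrixGroup.mem_maximalCompact_iff, archGroupGL, RealMatrixGroup.gl_carrier,
    Subgroup.mem_top, true_and, Subgroup.mem_inf, Subgroup.mem_iInf, Subgroup.mem_comap,
    mem_unitarySubgroupGL_iff]
  have hR : ∀ w, ((Matrix.GeneralLinearGroup.map (mixedSpaceEvalReal K w) g :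
      GL (Fin n) ℝ) : Matrix (Fin n) (Fin n) ℝ) =
        (g : Matrix _ _ _).map (mixedSpaceEvalReal K w) :=
    fun w => rfl
  have hC : ∀ w, ((Matrix.GeneralLinearGroup.map (mixedSpaceEvalComplex K w) g :
      GL (Fin n) ℂ) : Matrix (Fin n) (Fin n) ℂ) =
        (g : Matrix _ _ _).map (mixedSpaceEvalComplex K w) :=
    fun w => rfl
  have sR : ∀ w, (star (g : Matrix (Fin n) (Fin n) (mixedSpace K))).map
      (mixedSpaceEvalReal K w) = star ((g : Matrix _ _ _).map (mixedSpaceEvalReal K w)) :=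
    fun w => by
    rw [Matrix.star_eq_conjTranspose, Matrix.star_eq_conjTranspose, Matrix.conjTranspose_map]
    intro x
    rfl
  have sC : ∀ w, (star (g : Matrix (Fin n) (Fin n) (mixedSpace K))).map
      (mixedSpaceEvalComplex K w) = star ((g : Matrix _ _ _).map (mixedSpaceEvalComplex K w)) :=
    fun w => by
    rw [Matrix.star_eq_conjTranspose, Matrix.star_eq_conjTranspose, Matrix.conjTranspose_map]
    intro x
    rfl
  simp only [hR, hC, ← sR, ← sC, ← Matrix.map_mul]
  constructor
  · intro h
    refine ⟨fun w => ?_, fun w => ?_⟩ <;> rw [h] <;> simp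
  · rintro ⟨h₁, h₂⟩
    refine mixedSpace_matrix_ext n K (fun w => ?_) (fun w => ?_)
    · rw [h₁ w]; simp
    · rw [h₂ w]; simp

/-- The same description for `Kinf n K` (membership form): `g ∈ K_∞` iff `g_w ∈ O(n)` for every
real `w` and `g_w ∈ U(n)` for every complex `w`. Borel–Jacquet 1979, §1.1. [cite: BorelJacquet1979, §1.1] -/
theorem mem_Kinf_iff (g : GL (Fin n) (mixedSpace K)) :
    g ∈ Kinf n K ↔
      (∀ w : {w : InfinitePlace K // w.IsReal},
          Matrix.GeneralLinearGroup.map (mixedSpaceEvalReal K w) g ∈ unitarySubgroupGL ℝ (Fin n)) ∧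
        ∀ w : {w : InfinitePlace K // w.IsComplex},
          Matrix.GeneralLinearGroup.map (mixedSpaceEvalComplex K w) g ∈
            unitarySubgroupGL ℂ (Fin n) := by
  rw [Kinf, maximalCompact_archGroupGL_eq, Subgroup.mem_inf, Subgroup.mem_iInf, Subgroup.mem_iInf]
  rfl

end Arch

/-! ## `GL_n(K_∞)` inside `GL_n(𝔸_K)` -/

section Glue

/-- `GL_n(K_∞) ≃* GL_n(ℝ^{r₁} × ℂ^{r₂})`: Mathlib's ring isomorphism
`InfiniteAdeleRing.ringEquiv_mixedSpace K : K_∞ ≃+* mixedSpace K` applied entrywise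
(`RingEquiv.mapMatrix`) and restricted to units (`Units.mapEquiv`).
Borel–Jacquet 1979, §1.1 (`G_∞ = ∏_{w ∣ ∞} G(K_w)`). [cite: BorelJacquet1979, §1.1 ( G_∞ = ∏_{w ∣ ∞} G(K_w] -/
def GLn.infiniteEquivMixed : GL (Fin n) (InfiniteAdeleRing K) ≃* GL (Fin n) (mixedSpace K) :=
  Units.mapEquiv ((InfiniteAdeleRing.ringEquiv_mixedSpace K).mapMatrix (m := Fin n)).toMulEquiv

/-- The archimedean component `GL_n(𝔸_K) →* GL_n(K_∞) ≃* GL_n(mixedSpace K)`: G19's projection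
`GLn.fstHom` followed by `GLn.infiniteEquivMixed`. Borel–Jacquet 1979, §4.1 (`g = g_∞ g_f`). [cite: BorelJacquet1979, §4.1 ( g = g_∞ g_f] -/
def GLn.toMixed : GL (Fin n) (AdeleRing (𝓞 K) K) →* GL (Fin n) (mixedSpace K) :=
  (GLn.infiniteEquivMixed n K).toMonoidHom.comp (GLn.fstHom n K)

/-- `GLn.toMixed n K g = infiniteEquivMixed (fstHom g)` (definitional). [folklore] -/
theorem GLn.toMixed_apply (g : GL (Fin n) (AdeleRing (𝓞 K) K)) :
    GLn.toMixed n K g = GLn.infiniteEquivMixed n K (GLn.fstHom n K g) := rfl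

/-- The inclusion `K_∞ →ₙ+* 𝔸_K = K_∞ × 𝔸_K^∞`, `x ↦ (x, 0)`, of the archimedean direct factor of
the adele ring (a non-unital ring homomorphism, `NonUnitalRingHom.prod` of `id` and `0`).
Cassels–Fröhlich, *Algebraic Number Theory*, Ch. II §14. [folklore] -/
def infiniteAdeleInl : InfiniteAdeleRing K →ₙ+* AdeleRing (𝓞 K) K :=
  (NonUnitalRingHom.id (InfiniteAdeleRing K)).prod
    (0 : InfiniteAdeleRing K →ₙ+* FiniteAdeleRing (𝓞 K) K)

/-- `infiniteAdeleInl K x = (x, 0)` (definitional). [folklore] -/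
@[simp]
theorem infiniteAdeleInl_apply (x : InfiniteAdeleRing K) : infiniteAdeleInl K x = (x, 0) := rfl

/-- `x ↦ (x, 0) : K_∞ → 𝔸_K` is continuous. [folklore] -/
theorem continuous_infiniteAdeleInl : Continuous (infiniteAdeleInl K) :=
  Continuous.prodMk continuous_id continuous_const

/-- **The archimedean embedding** `GL_n(mixedSpace K) →* GL_n(𝔸_K)`, `g ↦ (g, 1)`: transport to
`GL_n(K_∞)` by `infiniteEquivMixed.symm`, then on matrices `M ↦ 1 + ι (M - 1)` for the factor
inclusion `ι = infiniteAdeleInl K` applied entrywise (G19's `oneAddHom`, an honest monoid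
homomorphism), then `Units.map` — exactly as the accepted `GLn.ofFinite`.
Borel–Jacquet 1979, §4.1; Godement–Jacquet, LNM 260, §10. [cite: BorelJacquet1979, §4.1] -/
def GLn.ofInfinite : GL (Fin n) (mixedSpace K) →* GL (Fin n) (AdeleRing (𝓞 K) K) :=
  (Units.map (oneAddHom ((infiniteAdeleInl K).mapMatrix (Fin n)))).comp
    (GLn.infiniteEquivMixed n K).symm.toMonoidHom

omit [NumberField K] in
/-- The inverse `mixedSpace K → K_∞` of Mathlib's `InfiniteAdeleRing.ringEquiv_mixedSpace K` is
continuous: componentwise it is the inverse of the isometry `K_w ≃ᵢ ℝ` resp. `K_w ≃ᵢ ℂ`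
(`isometryEquivRealOfIsReal`, `isometryEquivComplexOfIsComplex`). Mathlib records no topological
statement about `ringEquiv_mixedSpace`. Cassels–Fröhlich, Ch. II §14. [folklore] -/
theorem continuous_ringEquiv_mixedSpace_symm :
    Continuous (InfiniteAdeleRing.ringEquiv_mixedSpace K).symm := by
  set g : mixedSpace K → InfiniteAdeleRing K := fun x v =>
    if hv : InfinitePlace.IsReal v then
      (InfinitePlace.Completion.isometryEquivRealOfIsReal hv).symm (x.1 ⟨v, hv⟩)
    else (InfinitePlace.Completion.isometryEquivComplexOfIsComplex
      (InfinitePlace.not_isReal_iff_isComplex.1 hv)).symm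
        (x.2 ⟨v, InfinitePlace.not_isReal_iff_isComplex.1 hv⟩) with hg_def
  have hg : Continuous g := by
    refine continuous_pi fun v => ?_
    by_cases hv : InfinitePlace.IsReal v
    · simp only [hg_def, dif_pos hv]
      exact (IsometryEquiv.continuous _).comp ((continuous_apply _).comp continuous_fst)
    · simp only [hg_def, dif_neg hv]
      exact (IsometryEquiv.continuous _).comp ((continuous_apply _).comp continuous_snd)
  convert hg using 1
  funext x
  rw [RingEquiv.symm_apply_eq]
  ext w
  · obtain ⟨w, hw⟩ := w
    simp only [InfiniteAdeleRing.ringEquiv_mixedSpace_apply, hg_def, dif_pos hw]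
    exact ((InfinitePlace.Completion.isometryEquivRealOfIsReal hw).apply_symm_apply _).symm
  · obtain ⟨w, hw⟩ := w
    have hw' : ¬ InfinitePlace.IsReal w := InfinitePlace.not_isReal_iff_isComplex.2 hw
    simp only [InfiniteAdeleRing.ringEquiv_mixedSpace_apply, hg_def, dif_neg hw']
    exact ((InfinitePlace.Completion.isometryEquivComplexOfIsComplex hw).apply_symm_apply _).symm

omit [NumberField K] in
/-- Mathlib's `InfiniteAdeleRing.ringEquiv_mixedSpace K : K_∞ ≃+* mixedSpace K` is continuous
(componentwise the isometries `extensionEmbeddingOfIsReal`, `extensionEmbedding`).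
Cassels–Fröhlich, Ch. II §14. [folklore] -/
theorem continuous_ringEquiv_mixedSpace :
    Continuous (InfiniteAdeleRing.ringEquiv_mixedSpace K) := by
  refine continuous_prodMk.mpr ⟨continuous_pi fun w => ?_, continuous_pi fun w => ?_⟩
  · exact (InfinitePlace.Completion.isometry_extensionEmbeddingOfIsReal w.2).continuous.comp
      (continuous_apply _)
  · exact (InfinitePlace.Completion.isometry_extensionEmbedding w.1).continuous.comp
      (continuous_apply _)

/-- The archimedean component map `GL_n(𝔸_K) →* GL_n(mixedSpace K)` is continuous
(`Units.continuous_map`, `Continuous.matrix_map`). Borel–Jacquet 1979, §4.1. [cite: BorelJacquet1979, §4.1] -/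
theorem GLn.continuous_toMixed : Continuous (GLn.toMixed n K) := by
  refine (Units.continuous_map ?_).comp (Units.continuous_map ?_)
  · change Continuous fun M : Matrix (Fin n) (Fin n) (InfiniteAdeleRing K) =>
      M.map (InfiniteAdeleRing.ringEquiv_mixedSpace K)
    exact continuous_id.matrix_map (continuous_ringEquiv_mixedSpace K)
  · exact continuous_id.matrix_map continuous_fst

/-- **Continuity of the archimedean embedding** `GL_n(mixedSpace K) →* GL_n(𝔸_K)` (via
`Units.continuous_map`: both `Units.map` factors are induced by continuous maps of matrix rings).
Borel–Jacquet 1979, §4.1. [cite: BorelJacquet1979, §4.1] -/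
theorem GLn.continuous_ofInfinite : Continuous (GLn.ofInfinite n K) := by
  refine (Units.continuous_map ?_).comp (Units.continuous_map ?_)
  · have hF : Continuous fun M : Matrix (Fin n) (Fin n) (InfiniteAdeleRing K) =>
        M.map (infiniteAdeleInl K) :=
      continuous_id.matrix_map (continuous_infiniteAdeleInl K)
    exact continuous_const.add (hF.comp (continuous_id.sub continuous_const))
  · change Continuous fun M : Matrix (Fin n) (Fin n) (mixedSpace K) =>
      M.map (InfiniteAdeleRing.ringEquiv_mixedSpace K).symm
    exact continuous_id.matrix_map (continuous_ringEquiv_mixedSpace_symm K)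

variable {n K}

/-- An element of `GL_n(𝔸_K) = GL_n(K_∞ × 𝔸_K^∞)` is determined by its archimedean and finite
parts (`GLn.fstHom`, `GLn.sndHom`). Borel–Jacquet 1979, §4.1 (`G(𝔸) = G_∞ × G(𝔸_f)`). [cite: BorelJacquet1979, §4.1 ( G(𝔸] -/
theorem GLn.ext_of_fstHom_of_sndHom {x y : GL (Fin n) (AdeleRing (𝓞 K) K)}
    (h₁ : GLn.fstHom n K x = GLn.fstHom n K y) (h₂ : GLn.sndHom n K x = GLn.sndHom n K y) :
    x = y := by
  refine Matrix.GeneralLinearGroup.ext fun i j => Prod.ext ?_ ?_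
  · exact (Matrix.GeneralLinearGroup.ext_iff _ _).mp h₁ i j
  · exact (Matrix.GeneralLinearGroup.ext_iff _ _).mp h₂ i j

/-- Entries of `GLn.ofInfinite g`: `((ringEquiv_mixedSpace K).symm g_{ij}, δ_{ij})`
(definitional up to `add_sub_cancel`). Borel–Jacquet 1979, §4.1. [cite: BorelJacquet1979, §4.1] -/
theorem GLn.coe_ofInfinite_apply (g : GL (Fin n) (mixedSpace K)) (i j : Fin n) :
    (GLn.ofInfinite n K g : Matrix (Fin n) (Fin n) (AdeleRing (𝓞 K) K)) i j =
      ((InfiniteAdeleRing.ringEquiv_mixedSpace K).symm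
          ((g : Matrix (Fin n) (Fin n) (mixedSpace K)) i j),
        (1 : Matrix (Fin n) (Fin n) (FiniteAdeleRing (𝓞 K) K)) i j) := by
  refine Prod.ext ?_ ?_
  · change ((1 : Matrix (Fin n) (Fin n) (AdeleRing (𝓞 K) K)) i j).1 +
      ((InfiniteAdeleRing.ringEquiv_mixedSpace K).symm
          ((g : Matrix (Fin n) (Fin n) (mixedSpace K)) i j) -
        (1 : Matrix (Fin n) (Fin n) (InfiniteAdeleRing K)) i j) = _
    rw [Matrix.one_apply, Matrix.one_apply]
    split_ifs
    · change (1 : InfiniteAdeleRing K) + _ = _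
      rw [add_sub_cancel]
    · change (0 : InfiniteAdeleRing K) + _ = _
      rw [zero_add, sub_zero]
  · change ((1 : Matrix (Fin n) (Fin n) (AdeleRing (𝓞 K) K)) i j).2 + 0 = _
    rw [add_zero, Matrix.one_apply, Matrix.one_apply]
    split_ifs <;> rfl

/-- The finite part of `GLn.ofInfinite g` is `1`. Borel–Jacquet 1979, §4.1. [cite: BorelJacquet1979, §4.1] -/
@[simp]
theorem GLn.sndHom_ofInfinite (g : GL (Fin n) (mixedSpace K)) :
    GLn.sndHom n K (GLn.ofInfinite n K g) = 1 :=
  Matrix.GeneralLinearGroup.ext fun i j => by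
    change ((GLn.ofInfinite n K g : Matrix (Fin n) (Fin n) (AdeleRing (𝓞 K) K)) i j).2 = _
    rw [GLn.coe_ofInfinite_apply, Units.val_one]

/-- The archimedean part of `GLn.ofInfinite g` is `infiniteEquivMixed.symm g ∈ GL_n(K_∞)`.
Borel–Jacquet 1979, §4.1. [cite: BorelJacquet1979, §4.1] -/
@[simp]
theorem GLn.fstHom_ofInfinite (g : GL (Fin n) (mixedSpace K)) :
    GLn.fstHom n K (GLn.ofInfinite n K g) = (GLn.infiniteEquivMixed n K).symm g :=
  Matrix.GeneralLinearGroup.ext fun i j => by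
    change ((GLn.ofInfinite n K g : Matrix (Fin n) (Fin n) (AdeleRing (𝓞 K) K)) i j).1 = _
    rw [GLn.coe_ofInfinite_apply]
    rfl

/-- `GLn.toMixed` is a retraction of `GLn.ofInfinite`: `(g, 1)_∞ = g`. Borel–Jacquet 1979, §4.1. [cite: BorelJacquet1979, §4.1] -/
@[simp]
theorem GLn.toMixed_ofInfinite (g : GL (Fin n) (mixedSpace K)) :
    GLn.toMixed n K (GLn.ofInfinite n K g) = g := by
  rw [GLn.toMixed_apply, GLn.fstHom_ofInfinite, MulEquiv.apply_symm_apply]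

/-- The archimedean component of `GLn.ofFinite h = (1, h)` is `1`. Borel–Jacquet 1979, §4.1. [cite: BorelJacquet1979, §4.1] -/
@[simp]
theorem GLn.toMixed_ofFinite (h : GL (Fin n) (FiniteAdeleRing (𝓞 K) K)) :
    GLn.toMixed n K (GLn.ofFinite n K h) = 1 := by
  rw [GLn.toMixed_apply, GLn.fstHom_ofFinite, map_one]

/-- `GLn.ofInfinite` is injective. Borel–Jacquet 1979, §4.1. [cite: BorelJacquet1979, §4.1] -/
theorem GLn.ofInfinite_injective : Function.Injective (GLn.ofInfinite n K) :=
  Function.LeftInverse.injective GLn.toMixed_ofInfinite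

/-- **`G_∞` and `G(𝔸_f)` commute inside `G(𝔸_K)`**: `(g, 1)` and `(1, h)` commute in
`GL_n(K_∞ × 𝔸_K^∞)` (compare archimedean and finite parts). Borel–Jacquet 1979, §4.1. [cite: BorelJacquet1979, §4.1] -/
theorem GLn.commute_ofInfinite_ofFinite (g : GL (Fin n) (mixedSpace K))
    (h : GL (Fin n) (FiniteAdeleRing (𝓞 K) K)) :
    Commute (GLn.ofInfinite n K g) (GLn.ofFinite n K h) := by
  refine GLn.ext_of_fstHom_of_sndHom ?_ ?_
  · rw [map_mul, map_mul, GLn.fstHom_ofFinite, mul_one, one_mul]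
  · rw [map_mul, map_mul, GLn.sndHom_ofInfinite, mul_one, one_mul]

/-- Every `g ∈ GL_n(𝔸_K)` factors as `g = (g_∞, 1) · (1, g_f)`. Borel–Jacquet 1979, §4.1. [cite: BorelJacquet1979, §4.1] -/
theorem GLn.ofInfinite_toMixed_mul_ofFinite_sndHom (g : GL (Fin n) (AdeleRing (𝓞 K) K)) :
    GLn.ofInfinite n K (GLn.toMixed n K g) * GLn.ofFinite n K (GLn.sndHom n K g) = g := by
  refine GLn.ext_of_fstHom_of_sndHom ?_ ?_
  · rw [map_mul, GLn.fstHom_ofFinite, mul_one, GLn.fstHom_ofInfinite, GLn.toMixed_apply,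
      MulEquiv.symm_apply_apply]
  · rw [map_mul, GLn.sndHom_ofInfinite, one_mul, GLn.sndHom_ofFinite]

end Glue

/-! ## The adelic height on `GL_n(𝔸_K)` -/

section Height

/-- The **archimedean local height** `H_∞(g) = max_{i,j} (‖(g_∞)_{ij}‖ ⊔ ‖(g_∞⁻¹)_{ij}‖) ∈ ℝ≥0` of
`g ∈ GL_n(𝔸_K)`, where `g_∞ = GLn.toMixed g ∈ GL_n(ℝ^{r₁} × ℂ^{r₂})` and `‖·‖` is the sup norm of
the normed ring `mixedSpace K` (so `H_∞ = max_w H_w` over the archimedean places rather than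
Borel–Jacquet's `∏_w H_w`; both give the same moderate-growth condition). Junk value `0` for
`n = 0`. Borel–Jacquet 1979, §1.2; Moeglin–Waldspurger I.2.2. [cite: BorelJacquet1979, §1.2] -/
def GLn.archHeight (g : GL (Fin n) (AdeleRing (𝓞 K) K)) : ℝ≥0 :=
  Finset.univ.sup fun ij : Fin n × Fin n =>
    ‖(GLn.toMixed n K g : Matrix (Fin n) (Fin n) (mixedSpace K)) ij.1 ij.2‖₊ ⊔
      ‖(((GLn.toMixed n K g)⁻¹ : GL (Fin n) (mixedSpace K)) :
        Matrix (Fin n) (Fin n) (mixedSpace K)) ij.1 ij.2‖₊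

/-- The **local height** `H_v(g) = max_{i,j} (|(g_v)_{ij}|_v ⊔ |(g_v⁻¹)_{ij}|_v) ∈ ℝ≥0` of
`g ∈ GL_n(𝔸_K)` at a finite place `v`, where
`g_v = (AdelicGroupData.gl n K).toLocal v g = GeneralLinearGroup.map (adeleEval K v) g ∈ GL_n(K_v)`
(definitionally, `AdelicGroupData.gl_toLocal`) and `|·|_v` is the normalised absolute value of
`K_v` (Mathlib's norm on `v.adicCompletion K`).
It is `≥ 1`, and `= 1` iff `g_v ∈ GL_n(𝒪_v)`; junk value `0` for `n = 0`.
Borel–Jacquet 1979, §1.2; Moeglin–Waldspurger I.2.2. [cite: BorelJacquet1979, §1.2] -/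
def GLn.localHeight (v : HeightOneSpectrum (𝓞 K)) (g : GL (Fin n) (AdeleRing (𝓞 K) K)) :
    ℝ≥0 :=
  Finset.univ.sup fun ij : Fin n × Fin n =>
    ‖(Matrix.GeneralLinearGroup.map (AdelicGroupData.adeleEval K v) g :
        Matrix (Fin n) (Fin n) (v.adicCompletion K)) ij.1 ij.2‖₊ ⊔
      ‖(((Matrix.GeneralLinearGroup.map (AdelicGroupData.adeleEval K v) g)⁻¹ :
          GL (Fin n) (v.adicCompletion K)) :
        Matrix (Fin n) (Fin n) (v.adicCompletion K)) ij.1 ij.2‖₊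

/-- The **adelic height** `‖g‖ = H_∞(g) · ∏_v H_v(g)` on `GL_n(𝔸_K)` (finite product: `H_v(g) = 1`
for almost all `v`, `GLn.mulSupport_localHeight_finite`; Mathlib `finprod`), the height attached
to the embedding `g ↦ (g, g⁻¹)` of `GL_n` into affine space. Pure data: its properties are the
sorried theorems `adelicHeightGL_pos`, `adelicHeightGL_mul_le`; no axiom about it enters
`AutomorphyDatum.gl`. Borel–Jacquet 1979, §1.2 and §4.2; Moeglin–Waldspurger I.2.2. [cite: BorelJacquet1979, §1.2 and §4.2] -/
def adelicHeightGL (g : GL (Fin n) (AdeleRing (𝓞 K) K)) : ℝ :=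
  GLn.archHeight n K g * ∏ᶠ v, (GLn.localHeight n K v g : ℝ)

variable {n K}

/-- `H_v(g) = 1` for all but finitely many finite places `v` (the entries of `g` and `g⁻¹` are
`v`-integral for almost all `v`, and `max (|g_v|, |g_v⁻¹|) ≥ 1` always since `g_v g_v⁻¹ = 1`;
this needs `n ≥ 1`: for `n = 0` every `H_v` is the junk value `0`).
Borel–Jacquet 1979, §1.2; Moeglin–Waldspurger I.2.2. [cite: BorelJacquet1979, §1.2] -/
def GLn.mulSupport_localHeight_finite : Prop :=
  ∀ [NeZero n] (g : GL (Fin n) (AdeleRing (𝓞 K) K)),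
    (Function.mulSupport fun v => GLn.localHeight n K v g).Finite

/-- The adelic height is positive (`n ≥ 1`): every local factor is `≥ 1` at finite places and
`> 0` at infinity since `g_∞` is invertible. Borel–Jacquet 1979, §1.2 (property (i)). [cite: BorelJacquet1979, §1.2 (property (i] -/
def adelicHeightGL_pos : Prop :=
  ∀ [NeZero n] (g : GL (Fin n) (AdeleRing (𝓞 K) K)),
    0 < adelicHeightGL n K g

variable (n K) in
/-- Submultiplicativity of the adelic height up to a constant: `‖g h‖ ≤ C ‖g‖ ‖h‖`
(`C = n` works: ultrametric places are honestly submultiplicative, archimedean entries of a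
product are sums of `n` products). Borel–Jacquet 1979, §1.2 (property (ii));
Moeglin–Waldspurger I.2.2. [cite: BorelJacquet1979, §1.2 (property (ii] -/
def adelicHeightGL_mul_le : Prop :=
  ∃ C : ℝ, ∀ g h : GL (Fin n) (AdeleRing (𝓞 K) K),
      adelicHeightGL n K (g * h) ≤ C * adelicHeightGL n K g * adelicHeightGL n K h

/-- The height is symmetric: `‖g⁻¹‖ = ‖g‖` (the local heights are symmetric in `g, g⁻¹` by
definition). Borel–Jacquet 1979, §1.2. [cite: BorelJacquet1979, §1.2] -/
theorem adelicHeightGL_inv (g : GL (Fin n) (AdeleRing (𝓞 K) K)) :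
    adelicHeightGL n K g⁻¹ = adelicHeightGL n K g := by
  simp only [adelicHeightGL, GLn.archHeight, GLn.localHeight, map_inv, inv_inv, max_comm]

end Height

/-! ## Levels and the automorphy datum of `GL_n` -/

section Levels

/-- The admissible **levels** for `GL_n / K`: the subgroups `{1} × U₀ ≤ GL_n(𝔸_K)` for `U₀` a
compact open subgroup of `GL_n(𝔸_K^∞)` (image under G19's `GLn.ofFinite`).
Borel–Jacquet 1979, §4.1–4.2 (right invariance under a compact open subgroup of `G(𝔸_f)`). [cite: BorelJacquet1979, §4.1–4.2 (right invariance under a compa] -/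
def finiteLevelsGL : Set (Subgroup (GL (Fin n) (AdeleRing (𝓞 K) K))) :=
  {U | ∃ U₀ : Subgroup (GL (Fin n) (FiniteAdeleRing (𝓞 K) K)),
    IsOpen (U₀ : Set (GL (Fin n) (FiniteAdeleRing (𝓞 K) K))) ∧
      IsCompact (U₀ : Set (GL (Fin n) (FiniteAdeleRing (𝓞 K) K))) ∧ U = U₀.map (GLn.ofFinite n K)}

variable {n K} in
/-- Membership in `finiteLevelsGL` (definitional). Borel–Jacquet 1979, §4.1. [cite: BorelJacquet1979, §4.1] -/
theorem mem_finiteLevelsGL_iff {U : Subgroup (GL (Fin n) (AdeleRing (𝓞 K) K))} :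
    U ∈ finiteLevelsGL n K ↔ ∃ U₀ : Subgroup (GL (Fin n) (FiniteAdeleRing (𝓞 K) K)),
      IsOpen (U₀ : Set (GL (Fin n) (FiniteAdeleRing (𝓞 K) K))) ∧
        IsCompact (U₀ : Set (GL (Fin n) (FiniteAdeleRing (𝓞 K) K))) ∧
          U = U₀.map (GLn.ofFinite n K) :=
  Iff.rfl

variable {n K} in
/-- Levels are contained in `G(𝔸_f) = range GLn.ofFinite` (`Subgroup.map_le_range`).
Borel–Jacquet 1979, §4.1. [cite: BorelJacquet1979, §4.1] -/
theorem le_range_ofFinite_of_mem_finiteLevelsGL {U : Subgroup (GL (Fin n) (AdeleRing (𝓞 K) K))}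
    (hU : U ∈ finiteLevelsGL n K) : U ≤ (GLn.ofFinite n K).range := by
  obtain ⟨U₀, -, -, rfl⟩ := hU
  exact Subgroup.map_le_range _ _

/-- G19's integral level `K^max = {1} × GL_n(𝒪̂_K)` is the image of `GL_n(𝒪̂_K)` under
`GLn.ofFinite`. Godement–Jacquet, LNM 260, §10. [folklore] -/
theorem map_ofFinite_glFiniteIntegralLevel :
    (glFiniteIntegralLevel n K).map (GLn.ofFinite n K) = glIntegralLevel n K := by
  refine le_antisymm ?_ fun g hg => ?_
  · rintro _ ⟨h, hh, rfl⟩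
    exact GLn.ofFinite_mem_glIntegralLevel hh
  · rw [mem_glIntegralLevel_iff] at hg
    refine ⟨GLn.sndHom n K g, hg.1, GLn.ext_of_fstHom_of_sndHom ?_ ?_⟩
    · rw [GLn.fstHom_ofFinite, hg.2]
    · rw [GLn.sndHom_ofFinite]

/-- The integral level `K^max = {1} × GL_n(𝒪̂_K)` is an admissible level (`GL_n(𝒪̂_K)` is open,
`isOpen_glFiniteIntegralLevel`, and compact, `isCompact_glFiniteIntegralLevel`); in particular
`finiteLevelsGL n K` is non-empty. The compactness of `GL_n(𝒪̂_K)` (`isCompact_glFiniteIntegralLevel`)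
is the hypothesis `hcpt`. Godement–Jacquet, LNM 260, §10; Borel–Jacquet 1979, §4.1. [cite: BorelJacquet1979, §4.1] -/
theorem glIntegralLevel_mem_finiteLevelsGL (hcpt : isCompact_glFiniteIntegralLevel n K) :
    glIntegralLevel n K ∈ finiteLevelsGL n K :=
  ⟨glFiniteIntegralLevel n K, isOpen_glFiniteIntegralLevel n K, hcpt,
    (map_ofFinite_glFiniteIntegralLevel n K).symm⟩

/-- `finiteLevelsGL n K` is non-empty, given compactness of `GL_n(𝒪̂_K)` (`hcpt`).
Borel–Jacquet 1979, §4.1. [cite: BorelJacquet1979, §4.1] -/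
theorem finiteLevelsGL_nonempty (hcpt : isCompact_glFiniteIntegralLevel n K) :
    (finiteLevelsGL n K).Nonempty :=
  ⟨_, glIntegralLevel_mem_finiteLevelsGL n K hcpt⟩

/-- The principal congruence subgroups `K(𝔫)`, `𝔫 ≠ 0`, are admissible levels: the finite part
`{h ∈ GL_n(𝒪̂_K) | h_v ≡ 1 mod 𝔫𝒪_v}` is open (finitely many congruence conditions, each open) and
compact (closed in `GL_n(𝒪̂_K)`). Recorded as an independent named fact (the interim proof was
a `sorry`); its compactness half is a consequence of `isCompact_glFiniteIntegralLevel`, so it is a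
discharge candidate depending on `hcpt`. Godement–Jacquet, LNM 260, §10; Borel–Jacquet 1979,
§4.1. [cite: BorelJacquet1979, §4.1] -/
def principalCongruenceLevel_mem_finiteLevelsGL : Prop :=
  ∀ {𝔫 : Ideal (𝓞 K)} (_ : 𝔫 ≠ 0),
    principalCongruenceLevel n K 𝔫 ∈ finiteLevelsGL n K

/-- **The automorphy datum of `GL_n` over `K`** (Borel–Jacquet 1979, §4.1–4.2, for `G = GL_n`;
Godement–Jacquet, LNM 260, §10): `G_∞ = GL_n(ℝ^{r₁} × ℂ^{r₂})` (`archGroupGL`) embedded by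
`GLn.ofInfinite` (continuous), `G(𝔸_f) = range GLn.ofFinite` commuting with `G_∞`
(`GLn.commute_ofInfinite_ofFinite`), levels `finiteLevelsGL` (non-empty by the integral level),
and height `adelicHeightGL`. Every field is real; the compactness of `GL_n(𝒪̂_K)`
(`isCompact_glFiniteIntegralLevel`, used for non-emptiness of the levels) is the hypothesis `hcpt`. [cite: BorelJacquet1979, §4.1–4.2  for  G = GL_n] -/
def AutomorphyDatum.gl (hcpt : isCompact_glFiniteIntegralLevel n K) :
    AutomorphyDatum (AdelicGroupData.gl n K) (mixedSpace K) (Fin n) where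
  arch := archGroupGL n K
  ofArch := (GLn.ofInfinite n K).comp (archGroupGL n K).carrier.subtype
  continuous_ofArch := (GLn.continuous_ofInfinite n K).comp continuous_subtype_val
  finiteAdelic := (GLn.ofFinite n K).range
  commute_ofArch g := by
    rintro _ ⟨h, rfl⟩
    exact (GLn.commute_ofInfinite_ofFinite (g : GL (Fin n) (mixedSpace K)) h).eq
  finiteLevels := finiteLevelsGL n K
  finiteLevels_nonempty := finiteLevelsGL_nonempty n K hcpt
  le_finiteAdelic _ hU := le_range_ofFinite_of_mem_finiteLevelsGL hU
  height := adelicHeightGL n K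

/-- The archimedean group of `AutomorphyDatum.gl n K` is `archGroupGL n K` (definitional). [folklore] -/
@[simp]
theorem AutomorphyDatum.gl_arch (hcpt : isCompact_glFiniteIntegralLevel n K) :
    (AutomorphyDatum.gl n K hcpt).arch = archGroupGL n K := rfl

/-- `(AutomorphyDatum.gl n K hcpt).ofArch g = GLn.ofInfinite g` (definitional; not `simp` since the
left-hand side is not in simp-normal form). [folklore] -/
theorem AutomorphyDatum.gl_ofArch_apply (hcpt : isCompact_glFiniteIntegralLevel n K)
    (g : (archGroupGL n K).carrier) :
    (AutomorphyDatum.gl n K hcpt).ofArch g = GLn.ofInfinite n K g := rfl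

/-- The finite-adelic subgroup of `AutomorphyDatum.gl n K` is the range of `GLn.ofFinite`
(definitional). [folklore] -/
@[simp]
theorem AutomorphyDatum.gl_finiteAdelic (hcpt : isCompact_glFiniteIntegralLevel n K) :
    (AutomorphyDatum.gl n K hcpt).finiteAdelic = (GLn.ofFinite n K).range := rfl

/-- The levels of `AutomorphyDatum.gl n K` are `finiteLevelsGL n K` (definitional). [folklore] -/
@[simp]
theorem AutomorphyDatum.gl_finiteLevels (hcpt : isCompact_glFiniteIntegralLevel n K) :
    (AutomorphyDatum.gl n K hcpt).finiteLevels = finiteLevelsGL n K := rfl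

/-- The height of `AutomorphyDatum.gl n K` is `adelicHeightGL n K` (definitional). [folklore] -/
@[simp]
theorem AutomorphyDatum.gl_height (hcpt : isCompact_glFiniteIntegralLevel n K) :
    (AutomorphyDatum.gl n K hcpt).height = adelicHeightGL n K := rfl

/-- The maximal compact subgroup of the archimedean group of `AutomorphyDatum.gl n K` is `K_∞`
(definitional). Borel–Jacquet 1979, §4.1. [cite: BorelJacquet1979, §4.1] -/
theorem AutomorphyDatum.gl_arch_maximalCompact (hcpt : isCompact_glFiniteIntegralLevel n K) :
    (AutomorphyDatum.gl n K hcpt).arch.maximalCompact = Kinf n K := rfl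

end Levels

end Literature.NumberTheory.Automorphic
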